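import Summits.HubbardSuperconductivity.HubbardSuperconductivity.Theorems.AnisotropyChordTransferFibre3FinMHoleUpTo16
import Summits.HubbardSuperconductivity.HubbardSuperconductivity.Theorems.AnisotropyChordTransferFibre3FinMHoleSeventeen

/-!
# Route `AnisotropyChord` / H0 rotor rung: ★ the regime clause `mHole ≥ 0` for every ground profile, `9 ≤ L ≤ 17` (FIN-class, kernel-certified)

`mHole_nonneg_of_le_17`: `mHole_nonneg_of_le_16` (`…FinMHoleUpTo16`) extended by the split certificate `mHole_nonneg_seventeen`
(`…FinMHoleSeventeen`, evaluator `…FinSplitCellB`).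
Prover seat `hubbard-h0-rotor-p3` g4; helper for stmt-HubbardSuperconductivity-23918 (piece A of rung 19089; `--supports`, helper class).
WHAT THIS IS NOT: nothing here proves superconductivity in the Hubbard model; one hypothesis of ONE conditional reduction on a finite
range of `L`; the three β-free cruxes, the side condition and `18 ≤ L ≤ 30` remain. Tree imports only; no sorry.
-/

set_option linter.dupNamespace false
set_option autoImplicit false

namespace Summit.HubbardSuperconductivity.HubbardSuperconductivity.Theorems.AnisotropyChord.Transfer.Fibre3

/-- ★★ THE REGIME CLAUSE `mHole ≥ 0` FOR `9 ≤ L ≤ 17`: every ground two-magnon profile, `0 < Δ < 1`, has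
`T⁺ ≤ ε₁(1 − 5/V + 6/V²)/2` (FIN-class, kernel-certified with zero data). [folklore] -/
theorem mHole_nonneg_of_le_17 (L : ℕ) [NeZero L] (h9 : 9 ≤ L) (h17 : L ≤ 17) {Δ : ℝ} (hΔ0 : 0 < Δ) (hΔ1 : Δ < 1) :
    ∀ lam2 : ℝ, ∀ f : Tor L → ℝ, IsGroundTwoMagnon L Δ lam2 f → 0 ≤ mHole L Δ f := by
  by_cases h16 : L ≤ 16
  · exact mHole_nonneg_of_le_16 L h9 h16 hΔ0 hΔ1
  · have h : L = 17 := by omega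
    subst h
    exact mHole_nonneg_seventeen hΔ0 hΔ1

end Summit.HubbardSuperconductivity.HubbardSuperconductivity.Theorems.AnisotropyChord.Transfer.Fibre3
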